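import Mathlib
import HarnessLib
import Summits.NavierStokesRegularity.NavierStokesRegularity.Theorems.TypeIQuarterGateScarEnvelopeTypeIForcedTsaiAlgSoundF
import Summits.NavierStokesRegularity.NavierStokesRegularity.Theorems.TypeIQuarterGateScarEnvelopeTypeIForcedTsaiAlgWitnessL1F

/-!
# ARM B lane E-exact — ℓ = 1 Type-I rows with the certified floor AS TREE THEOREMS: δ/M = 15.87 @¼ … 18.26 @4

Closers of kernel-checked LANEX-ALG v2 rows (Type-I-tail witnesses with exact far-field closure and the CERTIFIED
POLYNOMIAL LEVEL FLOOR `floorCertT3K30`) through `AlgRowF.sound` (`…ForcedTsaiAlgSoundF`): certified UPPER bounds on the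
forced-Tsai modulus in the tree currency (`ℝ³`, weight `(1+ρ)⁵`, level on `B₁₀`):
`δ*(1/4) ≤ 3.968` (δ/M = 15.87); `δ*(1/2) ≤ 7.952` (δ/M = 15.90); `δ*(1) ≤ 16.04` (δ/M = 16.04); `δ*(2) ≤ 33.01` (δ/M = 16.51); `δ*(4) ≤ 73.04` (δ/M = 18.26).
«Near-profiles this good EXIST»; UPPER bounds only; excludes nothing; nothing about NS regularity; 23843 / H3 OPEN.
-/

set_option linter.dupNamespace false

namespace Summit.NavierStokesRegularity.NavierStokesRegularity.Cruxes.ScarEnvelopeTypeI.ForcedTsai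

/-- `δ*(1/4) ≤ 39677/10000` ≈ 3.9677 (Type-I-tail class, exact closure, certified polynomial floor; δ/M = 15.87). -/
theorem forcedTsaiModulusLE_algF_L1_1o4 : ForcedTsaiModulusLE (1 / 4 : ℝ) (39677 / 10000 : ℝ) := by
  have h := algRowFL1Fr0.sound algRowFL1Fr0_checkF
  norm_num [algRowFL1Fr0] at h
  exact h

/-- `δ*(1/2) ≤ 79519/10000` ≈ 7.9519 (Type-I-tail class, exact closure, certified polynomial floor; δ/M = 15.90). -/
theorem forcedTsaiModulusLE_algF_L1_1o2 : ForcedTsaiModulusLE (1 / 2 : ℝ) (79519 / 10000 : ℝ) := by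
  have h := algRowFL1Fr1.sound algRowFL1Fr1_checkF
  norm_num [algRowFL1Fr1] at h
  exact h

/-- `δ*(1) ≤ 3207/200` ≈ 16.0350 (Type-I-tail class, exact closure, certified polynomial floor; δ/M = 16.04). -/
theorem forcedTsaiModulusLE_algF_L1_1 : ForcedTsaiModulusLE (1 : ℝ) (3207 / 200 : ℝ) := by
  have h := algRowFL1Fr2.sound algRowFL1Fr2_checkF
  norm_num [algRowFL1Fr2] at h
  exact h

/-- `δ*(2) ≤ 165071/5000` ≈ 33.0142 (Type-I-tail class, exact closure, certified polynomial floor; δ/M = 16.51). -/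
theorem forcedTsaiModulusLE_algF_L1_2 : ForcedTsaiModulusLE (2 : ℝ) (165071 / 5000 : ℝ) := by
  have h := algRowFL1Fr3.sound algRowFL1Fr3_checkF
  norm_num [algRowFL1Fr3] at h
  exact h

/-- `δ*(4) ≤ 146089/2000` ≈ 73.0445 (Type-I-tail class, exact closure, certified polynomial floor; δ/M = 18.26). -/
theorem forcedTsaiModulusLE_algF_L1_4 : ForcedTsaiModulusLE (4 : ℝ) (146089 / 2000 : ℝ) := by
  have h := algRowFL1Fr4.sound algRowFL1Fr4_checkF
  norm_num [algRowFL1Fr4] at h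
  exact h

/-- Rounded: `ForcedTsaiModulusLE 1 (81/5)` (`δ/M ≤ 16.2` at level 1, Type-I-tail class; cf. `…_1_17q` v1 floor). -/
theorem forcedTsaiModulusLE_1_16p2 : ForcedTsaiModulusLE (1 : ℝ) (81 / 5 : ℝ) :=
  forcedTsaiModulusLE_algF_L1_1.mono le_rfl (by norm_num)

end Summit.NavierStokesRegularity.NavierStokesRegularity.Cruxes.ScarEnvelopeTypeI.ForcedTsai
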